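import Literature.Computability.QuantumComplexity.QueryWeightsTruncation
import HarnessLib

/-!
# Query magnitudes are additive in the target set

Topic `Literature/Computability/QuantumComplexity`; a bookkeeping sequel of `HybridArgument.lean` (BBBV query magnitudes
`queryWeight D e ψ = Σ_{x : queryOf e x ∈ D} |ψ x|²`, Bennett–Bernstein–Brassard–Vazirani 1997, Def. 3.2) and
`QueryWeightsTruncation.lean` (`queryWeights = map over oraclePositions`). The query magnitude of a finite DISJOINT union of
singletons `{σ i}`, `i ∈ S` (`σ` injective on `S`), is the sum of the query magnitudes of the singletons (BBBV 1997, proof of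
Cor. 3.4: "`q_T = Σ_{y ∈ T} q_y`"), gate by gate and for the totals along a run — the identity that turns a BLOCK node test
(sum over the relevant strings with a given prefix of their single-string magnitudes) into ONE event on the query register.

* **`queryWeight_setOf_exists_eq_sum`** — `queryWeight {q | ∃ i ∈ S, σ i = q} e ψ = Σ_{i ∈ S} queryWeight {σ i} e ψ`;
* **`queryWeights_getElem_setOf_exists_eq_sum`** — the same for the `t`-th query magnitude along a gate list;
* **`sum_queryWeights_setOf_exists_eq_sum`** — and for the total query magnitude along the run.

Everything here is PROVED; no definition, no named fact.

## References

* C. H. Bennett, E. Bernstein, G. Brassard, U. Vazirani, *Strengths and weaknesses of quantum computing*, SIAM J.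
  Comput. 26 (1997) 1510–1523, Def. 3.2, Cor. 3.4 (proof: `q_T = Σ_{y∈T} q_y`) [BennettBernsteinBrassardVazirani1997].
-/

noncomputable section

namespace Literature.Computability.QuantumComplexity

open Cryptography Matrix Finset

variable {G : QGateSet} {N : ℕ} {ι : Type*}

/-- A sum of indicators of the injective images is the indicator of the image set. [folklore] -/
private theorem sum_ite_eq_ite_exists (S : Finset ι) (σ : ι → List Bool) (hσ : Set.InjOn σ S) (q : List Bool) (c : ℝ)
    [Decidable (∃ i ∈ S, σ i = q)] [∀ i, Decidable (σ i = q)] :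
    (∑ i ∈ S, if σ i = q then c else 0) = if ∃ i ∈ S, σ i = q then c else 0 := by
  classical
  rw [Finset.sum_ite, Finset.sum_const_zero, add_zero, Finset.sum_const, nsmul_eq_mul]
  by_cases h : ∃ i ∈ S, σ i = q
  · obtain ⟨i, hi, rfl⟩ := h
    have hf : S.filter (fun j => σ j = σ i) = {i} := by
      ext j
      simp only [Finset.mem_filter, Finset.mem_singleton]
      constructor
      · rintro ⟨hj, hji⟩; exact hσ hj hi hji
      · rintro rfl; exact ⟨hi, rfl⟩
    rw [if_pos ⟨i, hi, rfl⟩, hf, Finset.card_singleton]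
    simp
  · rw [if_neg h]
    have hf : S.filter (fun j => σ j = q) = ∅ := Finset.filter_eq_empty_iff.2 fun j hj hq => h ⟨j, hj, hq⟩
    rw [hf, Finset.card_empty]
    simp

/-- **The query magnitude of a finite disjoint union of singletons is the sum of the singleton magnitudes.**
[cite: BennettBernsteinBrassardVazirani1997, Cor. 3.4 (proof: q_T = Σ_{y ∈ T} q_y)] -/
theorem queryWeight_setOf_exists_eq_sum {k : ℕ} (S : Finset ι) (σ : ι → List Bool) (hσ : Set.InjOn σ S)
    (e : Fin (k + 1) ↪ Fin N) (ψ : QReg N → ℂ) :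
    queryWeight {q | ∃ i ∈ S, σ i = q} e ψ = ∑ i ∈ S, queryWeight ({σ i} : Set (List Bool)) e ψ := by
  classical
  unfold queryWeight
  rw [Finset.sum_comm]
  refine Finset.sum_congr rfl fun x _ => ?_
  have h1 : ∀ i, (queryOf e x ∈ ({σ i} : Set (List Bool))) = (σ i = queryOf e x) := fun i => by
    rw [Set.mem_singleton_iff]; exact propext eq_comm
  simp only [Set.mem_setOf_eq, h1]
  rw [sum_ite_eq_ite_exists S σ hσ (queryOf e x) (‖ψ x‖ ^ 2)]
  congr 1

/-- **Additivity of the `t`-th query magnitude along a gate list.** [cite: BennettBernsteinBrassardVazirani1997, Cor. 3.4 (proof)] -/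
theorem queryWeights_getElem_setOf_exists_eq_sum (S : Finset ι) (σ : ι → List Bool) (hσ : Set.InjOn σ S)
    (A : Language Bool) (gs : List (QGate G N)) (ψ : QReg N → ℂ) (t : ℕ) (ht : t < (oraclePositions gs).length) :
    (queryWeights A {q | ∃ i ∈ S, σ i = q} gs ψ)[t]'(by
        rw [queryWeights_eq_map_oraclePositions, List.length_map]; exact ht) =
      ∑ i ∈ S, (queryWeights A ({σ i} : Set (List Bool)) gs ψ)[t]'(by
        rw [queryWeights_eq_map_oraclePositions, List.length_map]; exact ht) := by
  rw [queryWeights_getElem _ _ _ _ _ ht, queryWeight_setOf_exists_eq_sum S σ hσ]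
  refine Finset.sum_congr rfl fun i _ => ?_
  rw [queryWeights_getElem _ _ _ _ _ ht]

/-- **Additivity of the total query magnitude along a run.** [cite: BennettBernsteinBrassardVazirani1997, Cor. 3.4 (proof)] -/
theorem sum_queryWeights_setOf_exists_eq_sum (S : Finset ι) (σ : ι → List Bool) (hσ : Set.InjOn σ S)
    (A : Language Bool) (gs : List (QGate G N)) (ψ : QReg N → ℂ) :
    (queryWeights A {q | ∃ i ∈ S, σ i = q} gs ψ).sum = ∑ i ∈ S, (queryWeights A ({σ i} : Set (List Bool)) gs ψ).sum := by
  simp only [sum_queryWeights_eq_sum_oraclePositions, queryWeight_setOf_exists_eq_sum S σ hσ]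
  -- regroup: a list sum of Finset sums is the Finset sum of list sums
  induction oraclePositions gs with
  | nil => simp
  | cons q l ih => simp [List.sum_cons, Finset.sum_add_distrib, ih]

end Literature.Computability.QuantumComplexity

end
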